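import Literature.Geometry.Riemannian.SphericalCylinderEntropy
import Literature.Geometry.Riemannian.SphericalCylinderEntropyHeatEquation
import Literature.Geometry.Riemannian.SphericalCylinderEntropyZonalSmooth
import Mathlib.Analysis.Calculus.ParametricIntegral
import HarnessLib

/-!
# Route `CylinderEntropy`, crux `CylinderRungTwo` (stmt-SmoothPoincare4-7631), line `killing-flux`:
# the time derivative of the zonal heat smoothing on `S⁴` (registered helper
# `helper_heatSmoothingTimeDeriv`, step S3b of the area-quantization plan)

For a continuous `g : ℝ⁵ → ℝ`, a direction `w ∈ ℝ⁵` and a time `t > 0`, the zonal smoothing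
`T_{t'} g (w) = ∫_{S⁴} 𝔥(t', ⟨w, y⟩) g(y) dμH⁴(y)` (`𝔥 = zonal`, the typed zonal heat kernel of `S⁴`,
`= vol(S⁴) · H_{S⁴}` in the variable `s = ⟨w, y⟩ = ∑ᵢ wᵢ yᵢ`) is differentiable in the time at `t`, with

  `d/dt' |_{t' = t} T_{t'} g (w) = ∫_{S⁴} ((1 - s²) ∂_s² 𝔥(t, s) - 4 s ∂_s 𝔥(t, s)) g(y) dμH⁴(y)`,
  `s = ⟨w, y⟩`,

i.e. the heat equation `∂_t T_t g = Δ_{S⁴} T_t g` written through the zonal heat equation of the tree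
(`zonal_heat_equation`: `∂_τ 𝔥 = (1 - s²) ∂_s² 𝔥 - 4 s ∂_s 𝔥` on `(0, ∞) × ℝ`).  This is
differentiation under the integral sign (`hasDerivAt_integral_of_dominated_loc_of_deriv_le`) on the
finite measure `μH⁴⌊S⁴`: the pointwise time derivative is `hasDerivAt_zonal_tau_heat`, and on the
time half-line `t' > t/2` the derivative `∂_τ 𝔥(t', s) = -∑_k k(k+3) wt k t' · C_k(s)` is dominated,
uniformly in `t'` and in `|s| ≤ R` (`R = ∑ᵢ |wᵢ| + 1 ≥ |⟨w, y⟩|` on the unit sphere), by the summable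
Gaussian majorant `∑_k 4 e^{-k(k+3) t/2} (256 R)^k` of the tree (`abs_dwt_mul_gegen_le`,
`exp_weight_antitone`, `summable_exp_mul_pow_of_pos`), while `g` is bounded on the compact sphere.

* `abs_heat_zonal_le` — the uniform bound `|(1 - s²) ∂_s² 𝔥(t', s) - 4 s ∂_s 𝔥(t', s)| ≤ C(t, R)` for
  `t' > t/2`, `|s| ≤ R`;
* `abs_sum_mul_le_of_mem_sphere` — `|∑ᵢ wᵢ yᵢ| ≤ ∑ᵢ |wᵢ| + 1` on the unit sphere;
* `helper_heatSmoothingTimeDeriv` — the registered helper, verbatim.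

Everything here is PROVED (no `sorry`, no new definitions, no named facts).

References: R. S. Hamilton, *A matrix Harnack estimate for the heat equation*, Comm. Anal. Geom. 1
(1993) 113–126 (the heat kernel of the sphere); NIST DLMF §18.8 (Gegenbauer equation).
-/

-- the prescribed namespace `Summit.SmoothPoincare4.SmoothPoincare4.…` repeats `SmoothPoincare4`
set_option linter.dupNamespace false

noncomputable section

open MeasureTheory Set Filter
open scoped Manifold ContDiff ENNReal NNReal Topology BigOperators

namespace Summit.SmoothPoincare4.SmoothPoincare4.Cruxes.CylinderRungTwo.KillingFlux

open Literature.Geometry.Riemannian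
open Literature.Geometry.Riemannian.SphericalCylinderEntropy

/-- **Uniform bound for the heat operator applied to the zonal kernel**: for `t > 0`, `R ≥ 1`,
every `t' > t/2` and `|s| ≤ R`,
`|(1 - s²) ∂_s² 𝔥(t', s) - 4 s ∂_s 𝔥(t', s)| ≤ ∑_k 4 e^{-k(k+3) t/2} (256 R)^k`
(the left-hand side is `∂_τ 𝔥(t', s) = -∑_k k(k+3) wt k t' C_k(s)` by the zonal heat equation, and
each mode is dominated by the Gaussian majorant, antitone in the scale). [folklore] -/
theorem abs_heat_zonal_le {t : ℝ} (ht : 0 < t) {R : ℝ} (hR : 1 ≤ R) {x : ℝ} (hx : t / 2 < x)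
    {σ : ℝ} (hσ : |σ| ≤ R) :
    |(1 - σ ^ 2) * deriv (deriv (zonal x)) σ - 4 * σ * deriv (zonal x) σ| ≤
      ∑' k : ℕ, 4 * (Real.exp (-((k : ℝ) * ((k : ℝ) + 3)) * (t / 2)) * (256 * R) ^ k) := by
  have hx0 : 0 < x := by linarith
  rw [← zonal_heat_equation hx0 σ, deriv_zonal_tau hx0 σ]
  have hsum : Summable fun k : ℕ =>
      4 * (Real.exp (-((k : ℝ) * ((k : ℝ) + 3)) * (t / 2)) * (256 * R) ^ k) :=
    (summable_exp_mul_pow_of_pos (half_pos ht) (C := 256 * R) (by positivity)).mul_left 4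
  have key : ‖∑' k : ℕ, -((k : ℝ) * ((k : ℝ) + 3)) * wt k x * gegen k σ‖ ≤
      ∑' k : ℕ, 4 * (Real.exp (-((k : ℝ) * ((k : ℝ) + 3)) * (t / 2)) * (256 * R) ^ k) :=
    tsum_of_norm_bounded hsum.hasSum fun k => by
      rw [Real.norm_eq_abs]
      refine (abs_dwt_mul_gegen_le k x hR hσ).trans ?_
      have hmono := exp_weight_antitone k hx.le
      have h0 : (0 : ℝ) ≤ (256 * R) ^ k := by positivity
      nlinarith [mul_le_mul_of_nonneg_right hmono h0]
  rwa [Real.norm_eq_abs] at key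

/-- On the unit sphere of `ℝ⁵`, `|∑ᵢ wᵢ yᵢ| ≤ ∑ᵢ |wᵢ| + 1` (each `|yᵢ| ≤ ‖y‖ = 1`). [folklore] -/
theorem abs_sum_mul_le_of_mem_sphere (w : EuclideanSpace ℝ (Fin 5)) {y : EuclideanSpace ℝ (Fin 5)}
    (hy : y ∈ Metric.sphere (0 : EuclideanSpace ℝ (Fin 5)) 1) :
    |∑ i : Fin 5, w i * y i| ≤ ∑ i : Fin 5, |w i| + 1 := by
  have hy1 : ‖y‖ = 1 := mem_sphere_zero_iff_norm.1 hy
  have hyi : ∀ i : Fin 5, |y i| ≤ 1 := fun i => by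
    have h := PiLp.norm_apply_le y i
    rwa [Real.norm_eq_abs, hy1] at h
  calc |∑ i : Fin 5, w i * y i| ≤ ∑ i : Fin 5, |w i * y i| := Finset.abs_sum_le_sum_abs _ _
    _ ≤ ∑ i : Fin 5, |w i| := Finset.sum_le_sum fun i _ => by
        rw [abs_mul]
        calc |w i| * |y i| ≤ |w i| * 1 := mul_le_mul_of_nonneg_left (hyi i) (abs_nonneg _)
          _ = |w i| := mul_one _
    _ ≤ ∑ i : Fin 5, |w i| + 1 := by linarith

/-- **Registered helper `helper_heatSmoothingTimeDeriv` of line `killing-flux` (step S3b of the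
area-quantization plan: the zonal heat smoothing on `S⁴` solves the heat equation).** For continuous
`g : ℝ⁵ → ℝ`, `w ∈ ℝ⁵` and `t > 0`, with `s = ∑ᵢ wᵢ yᵢ` and `𝔥 = zonal`,
`t' ↦ ∫_{S⁴} 𝔥(t', s) g(y) dμH⁴(y)` has derivative
`∫_{S⁴} ((1 - s²) ∂_s² 𝔥(t, s) - 4 s ∂_s 𝔥(t, s)) g(y) dμH⁴(y)` at `t` (differentiation under the
integral sign on the finite measure `μH⁴⌊S⁴`, dominated on `t' > t/2` by `abs_heat_zonal_le` times
the maximum of `|g|` on the compact sphere; pointwise `hasDerivAt_zonal_tau_heat`). [folklore] -/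
theorem helper_heatSmoothingTimeDeriv : ∀ g : EuclideanSpace ℝ (Fin 5) → ℝ, Continuous g → ∀ w : EuclideanSpace ℝ (Fin 5), ∀ t : ℝ, 0 < t → HasDerivAt (fun t' : ℝ => ∫ y in Metric.sphere (0 : EuclideanSpace ℝ (Fin 5)) 1, Literature.Geometry.Riemannian.SphericalCylinderEntropy.zonal t' (∑ i : Fin 5, w i * y i) * g y ∂(μH[4] : Measure (EuclideanSpace ℝ (Fin 5)))) (∫ y in Metric.sphere (0 : EuclideanSpace ℝ (Fin 5)) 1, ((1 - (∑ i : Fin 5, w i * y i) ^ 2) * deriv (deriv (Literature.Geometry.Riemannian.SphericalCylinderEntropy.zonal t)) (∑ i : Fin 5, w i * y i) - 4 * (∑ i : Fin 5, w i * y i) * deriv (Literature.Geometry.Riemannian.SphericalCylinderEntropy.zonal t) (∑ i : Fin 5, w i * y i)) * g y ∂(μH[4] : Measure (EuclideanSpace ℝ (Fin 5)))) t := by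
  intro g hg w t ht
  have hSm : MeasurableSet (Metric.sphere (0 : EuclideanSpace ℝ (Fin 5)) 1) :=
    Metric.isClosed_sphere.measurableSet
  have hScpt : IsCompact (Metric.sphere (0 : EuclideanSpace ℝ (Fin 5)) 1) := isCompact_sphere 0 1
  haveI hfin : IsFiniteMeasure ((μH[4] : Measure (EuclideanSpace ℝ (Fin 5))).restrict
      (Metric.sphere (0 : EuclideanSpace ℝ (Fin 5)) 1)) :=
    isFiniteMeasure_restrict.2 hausdorffMeasure_sphere_four_lt_top.ne
  -- the linear form `s(y) = ∑ᵢ wᵢ yᵢ` and its bound on the sphere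
  have hs_cont : Continuous fun y : EuclideanSpace ℝ (Fin 5) => ∑ i : Fin 5, w i * y i := by
    fun_prop
  set R : ℝ := ∑ i : Fin 5, |w i| + 1 with hRdef
  have hR : 1 ≤ R := by
    have h0 : 0 ≤ ∑ i : Fin 5, |w i| := Finset.sum_nonneg fun i _ => abs_nonneg (w i)
    rw [hRdef]
    linarith
  -- `g` is bounded on the compact sphere
  obtain ⟨G, hG⟩ := hScpt.exists_bound_of_continuousOn hg.continuousOn
  -- continuity of `𝔥(x, ·)` and of its first two `s`-derivatives for `x > 0`
  have hzc : ∀ {x : ℝ}, 0 < x → Continuous (zonal x) := fun hx => (contDiff_zonal hx).continuous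
  have hd1 : ∀ {x : ℝ}, 0 < x → Continuous (deriv (zonal x)) := fun hx =>
    (contDiff_infty_iff_deriv.1 (contDiff_zonal hx)).2.continuous
  have hd2 : ∀ {x : ℝ}, 0 < x → Continuous (deriv (deriv (zonal x))) := fun hx =>
    (contDiff_infty_iff_deriv.1 (contDiff_infty_iff_deriv.1 (contDiff_zonal hx)).2).2.continuous
  -- the dominating constant
  set C : ℝ := ∑' k : ℕ, 4 * (Real.exp (-((k : ℝ) * ((k : ℝ) + 3)) * (t / 2)) * (256 * R) ^ k)
    with hCdef
  have hC0 : 0 ≤ C := tsum_nonneg fun k => by positivity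
  -- continuity (hence measurability) of the integrands
  have hF_cont : ∀ {x : ℝ}, 0 < x → Continuous fun y : EuclideanSpace ℝ (Fin 5) =>
      zonal x (∑ i : Fin 5, w i * y i) * g y := fun hx =>
    ((hzc hx).comp hs_cont).mul hg
  have hF'_cont : ∀ {x : ℝ}, 0 < x → Continuous fun y : EuclideanSpace ℝ (Fin 5) =>
      ((1 - (∑ i : Fin 5, w i * y i) ^ 2) * deriv (deriv (zonal x)) (∑ i : Fin 5, w i * y i)
        - 4 * (∑ i : Fin 5, w i * y i) * deriv (zonal x) (∑ i : Fin 5, w i * y i)) * g y :=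
    fun hx =>
    (((continuous_const.sub (hs_cont.pow 2)).mul ((hd2 hx).comp hs_cont)).sub
      ((continuous_const.mul hs_cont).mul ((hd1 hx).comp hs_cont))).mul hg
  -- `F t` is bounded on the sphere
  obtain ⟨B, hB⟩ := hScpt.exists_bound_of_continuousOn (hF_cont ht).continuousOn
  refine (hasDerivAt_integral_of_dominated_loc_of_deriv_le
    (μ := (μH[4] : Measure (EuclideanSpace ℝ (Fin 5))).restrict
      (Metric.sphere (0 : EuclideanSpace ℝ (Fin 5)) 1))
    (F := fun (t' : ℝ) (y : EuclideanSpace ℝ (Fin 5)) => zonal t' (∑ i : Fin 5, w i * y i) * g y)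
    (F' := fun (t' : ℝ) (y : EuclideanSpace ℝ (Fin 5)) =>
      ((1 - (∑ i : Fin 5, w i * y i) ^ 2) * deriv (deriv (zonal t')) (∑ i : Fin 5, w i * y i)
        - 4 * (∑ i : Fin 5, w i * y i) * deriv (zonal t') (∑ i : Fin 5, w i * y i)) * g y)
    (x₀ := t) (s := Set.Ioi (t / 2)) (bound := fun _ => C * G)
    (Ioi_mem_nhds (by linarith)) ?_ ?_ ?_ ?_ ?_ ?_).2
  · -- measurability of `F x` for `x` near `t`
    filter_upwards [Ioi_mem_nhds ht] with x hx
    exact (hF_cont hx).aestronglyMeasurable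
  · -- integrability of `F t` (bounded on a set of finite measure)
    exact Integrable.of_bound (hF_cont ht).aestronglyMeasurable B
      ((ae_restrict_mem hSm).mono fun y hy => hB y hy)
  · -- measurability of `F' t`
    exact (hF'_cont ht).aestronglyMeasurable
  · -- the uniform bound on `t' > t/2`
    refine (ae_restrict_mem hSm).mono fun y hy x hx => ?_
    rw [Real.norm_eq_abs, abs_mul]
    have hg' : |g y| ≤ G := by simpa only [Real.norm_eq_abs] using hG y hy
    exact mul_le_mul (abs_heat_zonal_le ht hR hx
      ((abs_sum_mul_le_of_mem_sphere w hy).trans le_rfl)) hg' (abs_nonneg _) hC0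
  · -- the constant bound is integrable
    exact integrable_const _
  · -- the pointwise time derivative (the zonal heat equation)
    refine Filter.Eventually.of_forall fun y x hx => ?_
    have hx0 : 0 < x := by linarith [Set.mem_Ioi.1 hx, ht]
    exact (hasDerivAt_zonal_tau_heat hx0 (∑ i : Fin 5, w i * y i)).mul_const (g y)

end Summit.SmoothPoincare4.SmoothPoincare4.Cruxes.CylinderRungTwo.KillingFlux

end
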